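import Literature.NumberTheory.EllipticCurves.IsogenyDualKernelLocalKummer
import Literature.NumberTheory.EllipticCurves.KubertTate1314RankLe
import Literature.NumberTheory.EllipticCurves.KubertTateFiveKummerValuation
import Literature.NumberTheory.EllipticCurves.TwoDescentTwoTorsionCharacter
import Mathlib.NumberTheory.Padics.HeightOneSpectrum
import Mathlib.Topology.Algebra.Valued.NormedValued
import Literature.NumberTheory.EllipticCurves.ConstantKernelIsogenySelmerTrivial
import Literature.NumberTheory.EllipticCurves.ShaIsogenyTorsionBound
import Literature.NumberTheory.EllipticCurves.IsogenyKummerSequenceProofs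
import Literature.NumberTheory.EllipticCurves.IsogenyMordellWeilRankProofs
import Literature.NumberTheory.EllipticCurves.TwoIsogenyShaTwoTorsion
import Literature.NumberTheory.EllipticCurves.X1ElevenKummerValues
import HarnessLib

/-!
# `Ш(E_{13/14}/ℚ)[5] = 0`: the `μ₅`-side of the `5`-descent on the Kubert–Tate curve
# `y² + xy − 2548y = x³ − 182x²` (rank `2`), via the Kummer invariant `Sel^ψ(E'/ℚ) ↪ ℚˣ/ℚˣ⁵`

PROOF-ONLY file (theorems; one private valuation helper; no named fact, no `sorry`), topic
`NumberTheory/EllipticCurves`; completes the `5`-descent on `E = E_{13/14} = kubertTateFive 13 14`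
(`T = (0,0)` of order `5`, `φ : E → E' = E/⟨T⟩` Vélu, tree `KubertTateVelu.fiveIsogeny 13 14`) begun in
`KubertTate1314FiveIsogeny` / `KubertTateFiveSelmerTame` (the `ℤ/5`-side `Sel^φ(E/ℚ) = 0`) and
`KubertTate1314RankLe` (`rank = 2`, `#E(ℚ)/5E(ℚ) = 125`). For ANY isogeny `ψ : E' → E` with `ψ ∘ φ = [5]`
(the dual):

* §1 `kummer_local` — **the local condition of `Sel^ψ(E'/ℚ)` at a `ℚ`-field `L`, in `Lˣ/Lˣ⁵`**: if the class of
  a cocycle `c` dies in `H¹(L, E')`, then a Kummer generator `(α, a)` of `c` has `aᵏ = u⁵` or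
  `aᵏ u⁵ = f_T(x, y)` in `L` for an `L`-point `(x, y) ≠ T` of `E`, some `k` prime to `5`
  (`IsogenyDualKernelLocalKummer` + the tree's Kummer function `f_T = xy − 14x² + 196y`,
  `KubertTateKummer.ord_kummerFn`, base point `P₁ = (−78, 936)` with `f_T(5P₁) ∈ ℚˣ⁵`).
* §2 `five_dvd_padicValRat_of_kummer_local` — over `L = ℚ_q`, `q ∉ {2, 7, 13}`: **`5 ∣ v_q(a)`**
  (the valuation lemma `KubertTateKummer.exists_val_kummerFn_eq_pow` at the `q`-adic norm); transported to
  the completions `ℚ_v` of the Selmer condition along `ℚ_v ≃ₐ[ℚ] ℚ_q`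
  (`Rat.HeightOneSpectrum.adicCompletion.padicEquiv`): **`five_dvd_padicValRat_of_mem_selmerGroup`**.
* §3 **`natCard_selmerGroup_dual_le : #Sel^ψ(E'/ℚ) ≤ 125`** — the Kummer invariant
  (`kummerInvariant`, injective) lands in the classes `[2^a 7^b 13^c]` (a rational number all of whose
  `q`-adic valuations are divisible by `5` is a fifth power, tree `X1Eleven.exists_eq_pow_of_forall_dvd_padicValRat`).
* §4 **`sha_torsionBy_five_eq_bot`, `shaCorank_five_eq_zero : t₅(E_{13/14}) = 0`** — with `#Sel^ψ =
  [E(ℚ) : 5E(ℚ)] · #ker Ш(ψ) = 125 · #ker Ш(ψ)` (tree `Isogeny.natCard_selmerGroup_eq`) the kernel `Ш(E')[ψ]`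
  is trivial, and with `Ш(E)[φ] = 0` the bracket of `ShaIsogenyTorsionBound` gives `Ш(E/ℚ)[5] = 0`:
  **the `5`-primary part of `Ш` of a rank-`2` elliptic curve over `ℚ` is finite, at a prime of good
  ordinary reduction, by descent alone** (no `L`-function, no conjecture); corollaries
  `primaryComponent_sha_five_eq_bot` (`Ш(E)[5^∞] = 0`), `selmerCorank_five_eq_two` (`s₅(E) = 2 = rank`),
  and on the isogenous curve `sha_torsionBy_five_E'_eq_bot`, `shaCorank_five_E'_eq_zero` (`Ш(E')[5] = 0`,
  `t₅(E') = 0`).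

## References

* [SilvermanAEC2009] J. H. Silverman, *AEC*, 2nd ed., Thm. X.4.2, Prop. X.4.9, Exercise 10.1(c), Thm. X.1.1.
* [Fisher2001FiveSevenDescent] T. Fisher, JEMS 3 (2001), §§1–2 (`5`-descent on curves with a `5`-torsion point).
* [Kubert1976] D. S. Kubert, *Universal bounds on the torsion of elliptic curves*, Table 3 (`N = 5`).
-/

noncomputable section

open scoped Classical NNReal NumberField AddSubgroup
open WeierstrassCurve WeierstrassCurve.Isogeny Field IsDedekindDomain
open Literature.NumberTheory.EllipticCurves Literature.NumberTheory.EllipticCurves.KubertTateKummer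
  Literature.NumberTheory.EllipticCurves.KubertTateVelu Literature.NumberTheory.GaloisRepresentations
  Literature.NumberTheory.EllipticCurves.WeierstrassFunctionField

-- The `ℚ`-algebra diamond on `AlgebraicClosure ℚ`: same device as `KubertTate1314Torsion`.
attribute [-instance] DivisionRing.toRatAlgebra

universe u

namespace Literature.NumberTheory.EllipticCurves

namespace KubertTate1314Descent

/-! ## §0 The data of the dual pair `(φ, ψ)` and `T̄` -/

variable (ψ : Isogeny (kubertTateFive' (13 : ℚ) 14) E) (hψ : ∀ P, ψ (fiveIsogeny (13 : ℚ) 14 P) = ((5 : ℕ) : ℤ) • P)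

/-- **The dual exists**: an isogeny `ψ : E' → E` with `ψ ∘ φ = [5]` (Silverman III.6.1, tree
`Isogeny.exists_dual_of_isElliptic`; `deg φ = #ker φ = 5`). [cite: SilvermanAEC2009, Thm. III.6.1(a)] -/
theorem exists_dual : ∃ ψ : Isogeny (kubertTateFive' (13 : ℚ) 14) E, ∀ P, ψ (fiveIsogeny (13 : ℚ) 14 P) = ((5 : ℕ) : ℤ) • P := by
  obtain ⟨ψ, hψ⟩ := (fiveIsogeny (13 : ℚ) 14).exists_dual_of_isElliptic
  refine ⟨ψ, fun P ↦ ?_⟩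
  rw [hψ, Isogeny.degree, natCard_ker_fiveIsogeny]

/-! ## §1 The local condition at a `ℚ`-field `L`, read in `Lˣ/Lˣ⁵` -/

section Local

variable (L : Type) [Field L] [Algebra ℚ L] [CharZero L]

omit [Algebra ℚ L] [CharZero L] in
/-- Transport of Kummer-function data along an equality of Weierstrass curves (both sides variables;
`subst`). [folklore] -/
private theorem kummerData_transport {V V' : WeierstrassCurve L} [V.IsElliptic] [V'.IsElliptic] (e : V = V') (n' : L)
    (h0' : (V'.baseChange (AlgebraicClosure L)).toAffine.Nonsingular 0 0)
    (hf : ∃ f : V'.geomFunctionField, f ≠ 0 ∧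
      (∀ Q : geomPoints V', ord (V'.baseChange (AlgebraicClosure L)).toAffine Q f =
        ((5 : ℕ) : ℤ) * ((if Q = Affine.Point.some 0 0 h0' then 1 else 0) - (if Q = 0 then 1 else 0))) ∧
      (∀ (x y : AlgebraicClosure L) (h : (V'.baseChange (AlgebraicClosure L)).toAffine.Nonsingular x y),
        V'.HasValueAt f (Affine.Point.some x y h)
          (x * y - algebraMap L (AlgebraicClosure L) n' * x ^ 2 + algebraMap L (AlgebraicClosure L) n' ^ 2 * y)))
    (h0 : (V.baseChange (AlgebraicClosure L)).toAffine.Nonsingular 0 0) :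
    ∃ f : V.geomFunctionField, f ≠ 0 ∧
      (∀ Q : geomPoints V, ord (V.baseChange (AlgebraicClosure L)).toAffine Q f =
        ((5 : ℕ) : ℤ) * ((if Q = Affine.Point.some 0 0 h0 then 1 else 0) - (if Q = 0 then 1 else 0))) ∧
      (∀ (x y : AlgebraicClosure L) (h : (V.baseChange (AlgebraicClosure L)).toAffine.Nonsingular x y),
        V.HasValueAt f (Affine.Point.some x y h)
          (x * y - algebraMap L (AlgebraicClosure L) n' * x ^ 2 + algebraMap L (AlgebraicClosure L) n' ^ 2 * y)) := by
  subst e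
  exact hf

/-- Two affine points with equal coordinates are equal (proof-irrelevant form). [folklore] -/
private theorem some_eq_some_of_eq {R : Type*} [CommRing R] {V : WeierstrassCurve R}
    {x y x' y' : R} (hx : x = x') (hy : y = y') (h : V.toAffine.Nonsingular x y)
    (h' : V.toAffine.Nonsingular x' y') : Affine.Point.some x y h = Affine.Point.some x' y' h' := by
  subst hx hy; rfl

omit [CharZero L] in
/-- `E ⊗ L = E_{13,14}` over `L` (the family is stable under base change, tree `map_kubertTateFive`). [cite: Kubert1976, Table 3 (N = 5)] -/
theorem E_baseChange_eq : E.baseChange L = kubertTateFive (13 : L) 14 := by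
  rw [show E.baseChange L = (kubertTateFive (13 : ℚ) 14).map (algebraMap ℚ L) from rfl, map_kubertTateFive]
  norm_num

omit [CharZero L] in
/-- `ι_*` of a rational affine point of `E` is the point with the same (rational) coordinates in `E_L(L̄)`.
[cite: SilvermanAEC2009, VIII.§1] -/
theorem baseExt_toGeom_some {x y : ℚ} (h : E.toAffine.Nonsingular x y) :
    ∃ h', baseExt E L (toGeom (.some x y h)) =
      .some (algebraMap ℚ (AlgebraicClosure L) x) (algebraMap ℚ (AlgebraicClosure L) y) h' := by
  obtain ⟨h₁, e₁⟩ := toGeom_some h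
  obtain ⟨h₂, e₂⟩ := Isogeny.localPointsEquivGeomPoints_pointsMap_some L E h₁
  rw [e₁, baseExt_apply, e₂]
  have hx : closureEmb (K := ℚ) L (algebraMap ℚ (AlgebraicClosure ℚ) x) = algebraMap ℚ (AlgebraicClosure L) x :=
    (closureEmb (K := ℚ) L).commutes x
  have hy : closureEmb (K := ℚ) L (algebraMap ℚ (AlgebraicClosure ℚ) y) = algebraMap ℚ (AlgebraicClosure L) y :=
    (closureEmb (K := ℚ) L).commutes y
  exact ⟨by rw [← hx, ← hy]; exact h₂, some_eq_some_of_eq hx hy _ _⟩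

omit [CharZero L] in
/-- `T_L = ι_* T̄ = (0, 0)` in `E_L(L̄)`. [cite: Kubert1976, Table 3 (N = 5)] -/
theorem baseExt_Tbar : ∃ h', baseExt E L (Tbar (13 : ℚ) 14) = .some 0 0 h' := by
  have hns : E.toAffine.Nonsingular 0 0 := (nonsingular_iff 0 0).mpr (by norm_num)
  obtain ⟨h', e⟩ := baseExt_toGeom_some L hns
  have hTe : T = Affine.Point.some 0 0 hns := rfl
  rw [← toGeom_T, hTe, e]
  have h0 : algebraMap ℚ (AlgebraicClosure L) 0 = 0 := map_zero _
  exact ⟨by rw [← h0]; exact h', some_eq_some_of_eq h0 h0 _ _⟩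

omit [CharZero L] in
/-- **A Kummer function `f_T` on `E_L` with `div f_T = 5(T_L) − 5(O)` and values `f_T(x, y) = xy − 14x² + 196y`**
(the tree's `KubertTateKummer.kummerFn 13 14` over `L`, transported along `E ⊗ L = E_{13,14}/L`).
[cite: SilvermanAEC2009, Exercise 10.1(c)] -/
theorem exists_kummerFn (h0 : ((E.baseChange L).baseChange (AlgebraicClosure L)).toAffine.Nonsingular 0 0) :
    ∃ f : (E.baseChange L).geomFunctionField, f ≠ 0 ∧
      (∀ Q : geomPoints (E.baseChange L), ord ((E.baseChange L).baseChange (AlgebraicClosure L)).toAffine Q f =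
        ((5 : ℕ) : ℤ) * ((if Q = Affine.Point.some 0 0 h0 then 1 else 0) - (if Q = 0 then 1 else 0))) ∧
      (∀ (x y : AlgebraicClosure L) (h : ((E.baseChange L).baseChange (AlgebraicClosure L)).toAffine.Nonsingular x y),
        (E.baseChange L).HasValueAt f (Affine.Point.some x y h)
          (x * y - algebraMap L (AlgebraicClosure L) 14 * x ^ 2 + algebraMap L (AlgebraicClosure L) 14 ^ 2 * y)) := by
  haveI : (kubertTateFive (13 : L) 14).IsElliptic := E_baseChange_eq L ▸ isElliptic_baseChange E L
  refine kummerData_transport L (E_baseChange_eq L) 14 (KubertTateKummer.nonsingular_zero_zero (13 : L) 14)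
    ⟨kummerFn (13 : L) 14, kummerFn_ne_zero (13 : L) 14, fun Q ↦ ?_, fun x y h ↦ hasValueAt_kummerFn (13 : L) 14 h⟩ h0
  rw [ord_kummerFn (13 : L) 14 Q, Tbar_eq]

/-- **`5P₁ ∉ ⟨T̄⟩`** (else `P₁ ∈ E(ℚ)[25] = ⟨T⟩`, but `x(P₁) = −78 ∉ {0, 182}`). [cite: Kubert1976, Table 3 (N = 5)] -/
theorem toGeom_five_nsmul_P₁_not_mem :
    toGeom ((5 : ℕ) • P₁) ∉ AddSubgroup.zmultiples (Tbar (13 : ℚ) 14) := by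
  intro hmem
  rw [← toGeom_T] at hmem
  obtain ⟨n, hn⟩ := AddSubgroup.mem_zmultiples_iff.mp hmem
  rw [← map_zsmul, toGeom_injective.eq_iff] at hn
  have h5 : (5 : ℕ) • ((5 : ℕ) • P₁) = 0 := by
    rw [← hn, smul_comm, five_nsmul_T, zsmul_zero]
  have h25 : P₁ ∈ AddSubgroup.torsionBy E.toAffine.Point ((25 : ℕ) : ℤ) :=
    AddSubgroup.torsionBy.nsmul_iff.mpr (by rw [show (25 : ℕ) = 5 * 5 from rfl, mul_nsmul, h5])
  rw [torsionBy_twentyfive_eq] at h25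
  unfold P₁ at h25
  rcases x_eq_of_mem_zmultiples_T h25 with h0 | h182
  · norm_num at h0
  · norm_num at h182

/-- A `Γ_L`-fixed point of `E_L(L̄)` off `O` is `(x, y)` with `x, y ∈ L`. [cite: SilvermanAEC2009, VIII.§1] -/
theorem exists_eq_some_of_fixed {P : geomPoints (E.baseChange L)}
    (hfix : ∀ τ : absoluteGaloisGroup L, τ • P = P) (hP0 : P ≠ 0) :
    ∃ (x y : L) (_ : (E.baseChange L).toAffine.Nonsingular x y)
      (h' : ((E.baseChange L).baseChange (AlgebraicClosure L)).toAffine.Nonsingular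
        (algebraMap L (AlgebraicClosure L) x) (algebraMap L (AlgebraicClosure L) y)),
      P = Affine.Point.some (algebraMap L (AlgebraicClosure L) x) (algebraMap L (AlgebraicClosure L) y) h' := by
  obtain ⟨Pr, hPr⟩ := exists_toGeomPoints_eq_of_forall_smul_eq (W := E.baseChange L) hfix
  rcases Pr with _ | ⟨x, y, h⟩
  · exact absurd (hPr.symm.trans (map_zero _)) hP0
  · exact ⟨x, y, h, _, by rw [← hPr]; exact Affine.Point.map_some _ h⟩

omit [CharZero L] in
/-- The Weierstrass equation of `E ⊗ L` in the Kubert–Tate shape. [cite: Kubert1976, Table 3 (N = 5)] -/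
theorem equation_iff (x y : L) :
    (E.baseChange L).toAffine.Equation x y ↔
      y ^ 2 + (14 - 13) * x * y - 13 * 14 ^ 2 * y = x ^ 3 - 13 * 14 * x ^ 2 := by
  rw [E_baseChange_eq, Affine.equation_iff]
  simp only [kubertTateFive]
  constructor <;> intro h <;> linear_combination h

/-- **The local condition of `Sel^ψ(E'/ℚ)` at `L`, read in `Lˣ/Lˣ⁵`.** Let `c : Γ_ℚ → ker ψ` be a cocycle whose
class dies in `H¹(L, E')` (`[c] ∈ ψ.selmerLocalKer L`) and `(α, a)` a Kummer generator of `c`. Then for some `k`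
with `5 ∤ k` and `u ∈ Lˣ`: either `aᵏ = u⁵` in `L`, or `aᵏ · u⁵ = xy − 14x² + 196y` for an `L`-rational affine point
`(x, y) ≠ (0,0) = T` of `E`. [cite: SilvermanAEC2009, Prop. X.4.9 and Exercise 10.1(c)] [cite: Fisher2001FiveSevenDescent, §2] -/
theorem kummer_local
    (c : letI := ψ.kerAction
      contOneCocycles (discreteTopRep (absoluteGaloisGroup ℚ) ψ.toAddMonoidHom.ker))
    (hsel : letI := ψ.kerAction
      oneCocycleClass _ c ∈ ψ.selmerLocalKer L)
    {α : (AlgebraicClosure ℚ)ˣ} {a : ℚˣ}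
    (hαp : α ^ 5 = Units.map (algebraMap ℚ (AlgebraicClosure ℚ) : ℚ →* AlgebraicClosure ℚ) a)
    (hcα : ∀ σ : absoluteGaloisGroup ℚ, muVal ℚ 5 (dualKerChar (fiveIsogeny (13 : ℚ) 14) ψ hψ (Tbar (13 : ℚ) 14)
      (five_zsmul_Tbar (13 : ℚ) 14) (ker_fiveIsogeny_eq_zmultiples (13 : ℚ) 14) (c.1 σ)) = σ • α / α) :
    ∃ (k : ℕ) (u x y : L), ¬ 5 ∣ k ∧ u ≠ 0 ∧
      ((algebraMap ℚ L a) ^ k = u ^ 5 ∨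
        (y ^ 2 + (14 - 13) * x * y - 13 * 14 ^ 2 * y = x ^ 3 - 13 * 14 * x ^ 2 ∧ ¬ (x = 0 ∧ y = 0) ∧
          (algebraMap ℚ L a) ^ k * u ^ 5 = x * y - 14 * x ^ 2 + 14 ^ 2 * y)) := by
  letI := ψ.kerAction
  set φ := fiveIsogeny (13 : ℚ) 14 with hφdef
  set T₀ := Tbar (13 : ℚ) 14 with hT₀
  have hT : ((5 : ℕ) : ℤ) • T₀ = 0 := five_zsmul_Tbar (13 : ℚ) 14
  have hT0 : T₀ ≠ 0 := Tbar_ne_zero (13 : ℚ) 14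
  have hTfix : ∀ σ : absoluteGaloisGroup ℚ, σ • T₀ = T₀ := smul_Tbar (13 : ℚ) 14
  have hker : φ.toAddMonoidHom.ker = AddSubgroup.zmultiples T₀ := ker_fiveIsogeny_eq_zmultiples (13 : ℚ) 14
  -- the base-changed isogenies
  obtain ⟨φL, hφL, -, hφLcard⟩ := Isogeny.exists_baseChange_field L φ
  obtain ⟨ψL, hψL, -, -⟩ := Isogeny.exists_baseChange_field L ψ
  letI := ψL.kerAction
  have hφL' : ∀ P : E.geomPoints, φL (baseExt E L P) = baseExt (kubertTateFive' (13 : ℚ) 14) L (φ P) := fun P ↦ hφL P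
  have hψL' : ∀ Q : (kubertTateFive' (13 : ℚ) 14).geomPoints, ψL (baseExt (kubertTateFive' (13 : ℚ) 14) L Q) = baseExt E L (ψ Q) := fun Q ↦ hψL Q
  have hφLcard' : Nat.card φL.toAddMonoidHom.ker = 5 := hφLcard.trans (natCard_ker_fiveIsogeny (13 : ℚ) 14)
  have hLp := comp_eq_zsmul_of_baseChange φ ψ hψ L φL ψL hφL' hψL'
  have hTL := zsmul_baseExt_T T₀ hT L
  have hTLfix := smul_baseExt_T T₀ hTfix L
  have hkerL := ker_baseChange_eq_zmultiples φ T₀ hT hT0 hker L φL hφL' hφLcard'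
  -- the Selmer condition at `L`: a coboundary `Q'`
  obtain ⟨Q', hQ'⟩ := exists_coboundary_of_mem_selmerLocalKer ψ L ψL hψL' c hsel
  -- `T_L = (0,0)` and the base point `Q₀ = ι_* P₁`
  obtain ⟨hT00, eTL⟩ := baseExt_Tbar L
  set Q₀ : geomPoints (E.baseChange L) := baseExt E L (toGeom P₁) with hQ₀def
  have hQ₀fix : ∀ τ : absoluteGaloisGroup L, τ • Q₀ = Q₀ := fun τ ↦ by
    rw [hQ₀def, ← baseExt_smul, smul_toGeom]
  obtain ⟨x₅, y₅, h₅, t₀, h5P₁, ht₀, hft₀⟩ := exists_f_five_nsmul_P₁_eq_pow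
  have h5Q₀ : ((5 : ℕ) : ℤ) • Q₀ = baseExt E L (toGeom ((5 : ℕ) • P₁)) := by
    rw [hQ₀def, natCast_zsmul, ← map_nsmul, ← map_nsmul]
  have hnotmem := toGeom_five_nsmul_P₁_not_mem
  have hQ₀0 : ((5 : ℕ) : ℤ) • Q₀ ≠ 0 := by
    rw [h5Q₀, Ne, ← (baseExt E L).map_zero, (baseExt_injective E L).eq_iff]
    exact fun h0 ↦ hnotmem (h0 ▸ (AddSubgroup.zmultiples _).zero_mem)
  have hQ₀T : ((5 : ℕ) : ℤ) • Q₀ ≠ baseExt E L T₀ := by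
    rw [h5Q₀, Ne, (baseExt_injective E L).eq_iff]
    exact fun h0 ↦ hnotmem (h0 ▸ AddSubgroup.mem_zmultiples _)
  have hQ₀negT : ((5 : ℕ) : ℤ) • Q₀ ≠ -baseExt E L T₀ := by
    rw [h5Q₀, ← map_neg, Ne, (baseExt_injective E L).eq_iff]
    exact fun h0 ↦ hnotmem (h0 ▸ (AddSubgroup.zmultiples _).neg_mem (AddSubgroup.mem_zmultiples _))
  -- the Kummer function on `E_L` and its value at `5Q₀ = ι_*(5P₁)`
  obtain ⟨fL, hfL0, hfLord, hfLval⟩ := exists_kummerFn L hT00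
  have hfLord' : ∀ Q : geomPoints (E.baseChange L),
      ord ((E.baseChange L).baseChange (AlgebraicClosure L)).toAffine Q fL =
        ((5 : ℕ) : ℤ) * ((if Q = baseExt E L T₀ then 1 else 0) - (if Q = 0 then 1 else 0)) := by
    intro Q; rw [hfLord Q, eTL]
  obtain ⟨h₅', e₅⟩ := baseExt_toGeom_some L h₅
  have ha₀ : (E.baseChange L).HasValueAt fL (((5 : ℕ) : ℤ) • Q₀)
      (algebraMap L (AlgebraicClosure L) (algebraMap ℚ L t₀ ^ 5)) := by
    rw [h5Q₀, h5P₁, e₅]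
    refine (hfLval _ _ h₅').congr rfl ?_
    rw [map_pow, ← IsScalarTower.algebraMap_apply ℚ L (AlgebraicClosure L),
      ← map_pow (algebraMap ℚ (AlgebraicClosure L)) t₀ 5, ← hft₀]
    simp only [map_sub, map_add, map_mul, map_pow, map_ofNat]
  -- case `P = ψ_L Q' = O`
  by_cases hP0 : ψL Q' = 0
  · obtain ⟨k, u, hk, hu0, hu⟩ := exists_pow_eq_pow_of_psi_eq_zero φ ψ hψ T₀ hT hT0 hTfix hker L φL ψL
      hφL' hψL' hφLcard' c hQ' hP0 hαp hcα
    exact ⟨k, u, 0, 0, hk, hu0, Or.inl hu⟩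
  -- otherwise translate `Q'` by `X ∈ {O, φ_L Q₀}` so that `ψ_L(Q' + X) ∉ {O, T_L}`
  obtain ⟨X, hXfix, hP0', hPT'⟩ : ∃ X : geomPoints ((kubertTateFive' (13 : ℚ) 14).baseChange L),
      (∀ τ : absoluteGaloisGroup L, τ • X = X) ∧ ψL (Q' + X) ≠ 0 ∧ ψL (Q' + X) ≠ baseExt E L T₀ := by
    by_cases hPT : ψL Q' = baseExt E L T₀
    · refine ⟨φL Q₀, fun τ ↦ by rw [← Isogeny.map_smul, hQ₀fix], ?_, ?_⟩
      · rw [map_add, hLp, hPT]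
        exact fun h0 ↦ hQ₀negT (eq_neg_of_add_eq_zero_right h0)
      · rw [map_add, hLp, hPT]
        exact fun h0 ↦ hQ₀0 (add_eq_left.mp h0)
    · exact ⟨0, fun τ ↦ smul_zero τ, by rwa [add_zero], by rwa [add_zero]⟩
  have hc' : ∀ τ : absoluteGaloisGroup L,
      (((Isogeny.resCocycle ψ L ψL hψL' c).1 τ : ψL.toAddMonoidHom.ker) : geomPoints ((kubertTateFive' (13 : ℚ) 14).baseChange L)) =
        τ • (Q' + X) - (Q' + X) := fun τ ↦ by
    rw [hQ' τ, smul_add, hXfix τ]; abel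
  -- the point `P = ψ_L(Q' + X)` is `L`-rational: `P = (x, y)`
  have hPfix : ∀ τ : absoluteGaloisGroup L, τ • ψL (Q' + X) = ψL (Q' + X) :=
    smul_psi_eq_of_coboundary ψL (Isogeny.resCocycle ψ L ψL hψL' c) hc'
  obtain ⟨x, y, hxy, hxy', ePxy⟩ := exists_eq_some_of_fixed L hPfix hP0'
  have hb : (E.baseChange L).HasValueAt fL (ψL (Q' + X))
      (algebraMap L (AlgebraicClosure L) (x * y - 14 * x ^ 2 + 14 ^ 2 * y)) := by
    rw [ePxy]
    refine (hfLval _ _ hxy').congr rfl ?_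
    simp only [map_sub, map_add, map_mul, map_pow, map_ofNat]
  -- the Kummer invariant is the descent value
  obtain ⟨k, u, hk, hu0, hu⟩ := exists_pow_mul_pow_eq_value_of_coboundary φ ψ hψ T₀ hT hT0 hTfix hker L φL ψL
    hφL' hψL' hφLcard' hfL0 hfLord' c hc' hP0' hPT' hb hQ₀0 hQ₀T hQ₀fix ha₀ hαp hcα
  refine ⟨k, u * algebraMap ℚ L t₀, x, y, hk, mul_ne_zero hu0 (by
      rw [Ne, map_eq_zero_iff _ (algebraMap ℚ L).injective]; exact ht₀), Or.inr ⟨?_, ?_, ?_⟩⟩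
  · exact (equation_iff L x y).mp hxy.left
  · rintro ⟨rfl, rfl⟩
    apply hPT'
    rw [ePxy, eTL]
    exact some_eq_some_of_eq (map_zero _) (map_zero _) _ _
  · apply (algebraMap L (AlgebraicClosure L)).injective
    rw [← hu, ← map_mul]
    congr 1
    ring

end Local

/-! ## §2 Over `ℚ_q`, `q ∉ {2, 7, 13}`: the valuation of the Kummer invariant is divisible by `5` -/

section Padic

variable (q : ℕ) [Fact q.Prime]

/-- `‖x‖ = ‖z‖⁵ ⟹ v_q(x) = 5 v_q(z)` in `ℚ_q` (for `x, z ≠ 0`). [folklore] -/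
private theorem valuation_eq_five_mul_of_norm_eq {x z : ℚ_[q]} (hx : x ≠ 0) (hz : z ≠ 0)
    (h : ‖x‖ = ‖z‖ ^ 5) : x.valuation = 5 * z.valuation := by
  have hq : (1 : ℝ) < q := by exact_mod_cast (Fact.out : q.Prime).one_lt
  rw [Padic.norm_eq_zpow_neg_valuation hx, Padic.norm_eq_zpow_neg_valuation hz, ← zpow_natCast, ← zpow_mul] at h
  have := zpow_right_injective₀ (zero_lt_one.trans hq) hq.ne' h
  push_cast at this
  linarith

/-- **`5 ∣ v_q(a)` from the local reading at `ℚ_q`**, `q ∉ {2, 7, 13}`: if `aᵏ = u⁵`, or `aᵏ u⁵ = f_T(x, y)` at a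
`ℚ_q`-point `(x, y) ≠ T` of `E` (where `v_q(f_T(x, y)) ∈ 5ℤ` by the tree's valuation lemma
`KubertTateKummer.exists_val_kummerFn_eq_pow` at the `q`-adic norm, `13, 14` being `q`-units), with `5 ∤ k`.
[cite: SilvermanAEC2009, Exercise 10.1(c)] [cite: Fisher2001FiveSevenDescent, §2] -/
theorem five_dvd_padicValRat_of_kummer_local (hq2 : q ≠ 2) (hq7 : q ≠ 7) (hq13 : q ≠ 13) {a : ℚ} (ha : a ≠ 0)
    {k : ℕ} {u x y : ℚ_[q]} (hk : ¬ 5 ∣ k) (hu : u ≠ 0)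
    (h : (a : ℚ_[q]) ^ k = u ^ 5 ∨
      (y ^ 2 + (14 - 13) * x * y - 13 * 14 ^ 2 * y = x ^ 3 - 13 * 14 * x ^ 2 ∧ ¬ (x = 0 ∧ y = 0) ∧
        (a : ℚ_[q]) ^ k * u ^ 5 = x * y - 14 * x ^ 2 + 14 ^ 2 * y)) :
    (5 : ℤ) ∣ padicValRat q a := by
  have ha' : (a : ℚ_[q]) ≠ 0 := by exact_mod_cast ha
  have hcop : IsCoprime (5 : ℤ) (k : ℤ) := by
    have h5 : IsCoprime ((5 : ℕ) : ℤ) (k : ℤ) :=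
      Nat.isCoprime_iff_coprime.mpr ((Nat.Prime.coprime_iff_not_dvd Nat.prime_five).mpr hk)
    exact_mod_cast h5
  -- `k · v_q(a) ∈ 5ℤ` suffices
  suffices hkv : (5 : ℤ) ∣ (k : ℤ) * padicValRat q a by
    rw [mul_comm] at hkv
    exact hcop.dvd_of_dvd_mul_right hkv
  rw [← Padic.valuation_ratCast, ← Padic.valuation_pow]
  rcases h with h | ⟨he, hT, h⟩
  · rw [h, Padic.valuation_pow]
    exact ⟨u.valuation, by push_cast; ring⟩
  · -- the valuation lemma at the `q`-adic norm
    set w : Valuation ℚ_[q] ℝ≥0 := NormedField.valuation with hw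
    have hnat : ∀ {n : ℕ}, q.Coprime n → w (n : ℚ_[q]) = 1 := fun hn ↦ by
      rw [hw, NormedField.valuation_apply, ← NNReal.coe_inj, coe_nnnorm, NNReal.coe_one]
      exact Padic.norm_natCast_eq_one_iff.mpr hn
    have hcop' : ∀ {n : ℕ}, n.Prime → q ≠ n → q.Coprime n := fun hn hne ↦
      (Nat.coprime_primes (Fact.out : q.Prime) hn).mpr hne
    have h13 : w (13 : ℚ_[q]) = 1 := by
      have := hnat (hcop' (by norm_num) hq13); exact_mod_cast this
    have h14 : w (14 : ℚ_[q]) = 1 := by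
      have h2 := hnat (hcop' Nat.prime_two hq2)
      have h7 := hnat (hcop' (by norm_num) hq7)
      have : (14 : ℚ_[q]) = (2 : ℕ) * (7 : ℕ) := by norm_num
      rw [this, map_mul, h2, h7, mul_one]
    obtain ⟨z, hz0, hz⟩ := KubertTateKummer.exists_val_kummerFn_eq_pow w h13 h14 he hT
    have hF0 : x * y - 14 * x ^ 2 + 14 ^ 2 * y ≠ 0 := by
      intro h0
      rw [h0, map_zero, eq_comm, pow_eq_zero_iff (by norm_num : 5 ≠ 0), map_eq_zero] at hz
      exact hz0 hz
    have hnorm : ‖x * y - 14 * x ^ 2 + 14 ^ 2 * y‖ = ‖z‖ ^ 5 := by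
      have := congrArg (fun t : ℝ≥0 ↦ (t : ℝ)) hz
      simpa [hw, NormedField.valuation_apply] using this
    have hval := valuation_eq_five_mul_of_norm_eq q hF0 hz0 hnorm
    rw [← h, Padic.valuation_mul (pow_ne_zero _ ha') (pow_ne_zero _ hu), Padic.valuation_pow,
      Padic.valuation_pow] at hval
    rw [Padic.valuation_pow]
    exact ⟨z.valuation - u.valuation, by push_cast at hval ⊢; linarith⟩

end Padic

/-! ## §3 The Selmer condition at every finite place: `5 ∣ v_q` of the Kummer invariant, `q ∉ {2, 7, 13}` -/

/-- Transport of the local reading along `ℚ_v ≃ₐ[ℚ] ℚ_q` (Mathlib `Rat.HeightOneSpectrum.adicCompletion.padicEquiv`).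
[folklore] -/
private theorem kummer_local_transport {L L' : Type*} [Field L] [Algebra ℚ L] [Field L'] [Algebra ℚ L']
    [CharZero L'] (e : L ≃ₐ[ℚ] L') {a : ℚ} {k : ℕ} {u x y : L} (hu : u ≠ 0)
    (h : (algebraMap ℚ L a) ^ k = u ^ 5 ∨
      (y ^ 2 + (14 - 13) * x * y - 13 * 14 ^ 2 * y = x ^ 3 - 13 * 14 * x ^ 2 ∧ ¬ (x = 0 ∧ y = 0) ∧
        (algebraMap ℚ L a) ^ k * u ^ 5 = x * y - 14 * x ^ 2 + 14 ^ 2 * y)) :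
    ∃ u' x' y' : L', u' ≠ 0 ∧ ((algebraMap ℚ L' a) ^ k = u' ^ 5 ∨
      (y' ^ 2 + (14 - 13) * x' * y' - 13 * 14 ^ 2 * y' = x' ^ 3 - 13 * 14 * x' ^ 2 ∧ ¬ (x' = 0 ∧ y' = 0) ∧
        (algebraMap ℚ L' a) ^ k * u' ^ 5 = x' * y' - 14 * x' ^ 2 + 14 ^ 2 * y')) := by
  have hea : e (algebraMap ℚ L a) = algebraMap ℚ L' a := e.commutes a
  refine ⟨e u, e x, e y, (map_ne_zero e).mpr hu, ?_⟩
  rcases h with h | ⟨he, hT, h⟩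
  · left
    have := congrArg e h
    simpa [map_pow, hea] using this
  · right
    refine ⟨?_, ?_, ?_⟩
    · have := congrArg e he
      simpa [map_pow, map_mul, map_sub, map_add, map_ofNat] using this
    · rintro ⟨hx, hy⟩
      exact hT ⟨(map_eq_zero e).mp hx, (map_eq_zero e).mp hy⟩
    · have := congrArg e h
      simpa [map_pow, map_mul, map_sub, map_add, map_ofNat, hea] using this

/-- **`5 ∣ v_q(a)` for every prime `q ∉ {2, 7, 13}`** when `(α, a)` is a Kummer generator of a cocycle `c` whose class
lies in the `ψ`-Selmer group (local condition at the place `v ↔ q`, read via `kummer_local` at `ℚ_v` and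
`five_dvd_padicValRat_of_kummer_local` at `ℚ_q ≅ ℚ_v`). [cite: SilvermanAEC2009, Thm. X.4.2 and Prop. X.4.9]
[cite: Fisher2001FiveSevenDescent, §2] -/
theorem five_dvd_padicValRat_of_generator
    (c : letI := ψ.kerAction
      contOneCocycles (discreteTopRep (absoluteGaloisGroup ℚ) ψ.toAddMonoidHom.ker))
    (hsel : letI := ψ.kerAction
      oneCocycleClass _ c ∈ ψ.selmerGroup)
    {α : (AlgebraicClosure ℚ)ˣ} {a : ℚˣ}
    (hαp : α ^ 5 = Units.map (algebraMap ℚ (AlgebraicClosure ℚ) : ℚ →* AlgebraicClosure ℚ) a)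
    (hcα : ∀ σ : absoluteGaloisGroup ℚ, muVal ℚ 5 (dualKerChar (fiveIsogeny (13 : ℚ) 14) ψ hψ (Tbar (13 : ℚ) 14)
      (five_zsmul_Tbar (13 : ℚ) 14) (ker_fiveIsogeny_eq_zmultiples (13 : ℚ) 14) (c.1 σ)) = σ • α / α)
    (q : ℕ) [Fact q.Prime] (hq2 : q ≠ 2) (hq7 : q ≠ 7) (hq13 : q ≠ 13) :
    (5 : ℤ) ∣ padicValRat q (a : ℚ) := by
  letI := ψ.kerAction
  -- every prime is `primesEquiv v` for a finite place `v` of `𝓞 ℚ`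
  have key : ∀ v : HeightOneSpectrum (𝓞 ℚ), (Rat.HeightOneSpectrum.primesEquiv v).1 = q →
      (5 : ℤ) ∣ padicValRat q (a : ℚ) := by
    intro v hv
    set L := v.adicCompletion ℚ
    haveI : CharZero L := charZero_of_injective_algebraMap (algebraMap ℚ L).injective
    have hloc := ((ψ.mem_selmerGroup_iff _).mp hsel).1 v
    obtain ⟨k, u, x, y, hk, hu, h⟩ := kummer_local ψ hψ L c hloc hαp hcα
    haveI : Fact (Nat.Prime (Rat.HeightOneSpectrum.primesEquiv (R := 𝓞 ℚ) v).1) :=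
      ⟨(Rat.HeightOneSpectrum.primesEquiv v).2⟩
    -- the `ℚ`-algebra structure of `ℚ_q` (Mathlib's `DivisionRing.toRatAlgebra`, disabled above for `ℚ̄`)
    letI : Algebra ℚ ℚ_[(Rat.HeightOneSpectrum.primesEquiv (R := 𝓞 ℚ) v).1] := DivisionRing.toRatAlgebra
    have e := (Rat.HeightOneSpectrum.adicCompletion.padicEquiv (R := 𝓞 ℚ) v).toAlgEquiv
    obtain ⟨u', x', y', hu', h'⟩ := kummer_local_transport e hu h
    subst hv
    refine five_dvd_padicValRat_of_kummer_local _ hq2 hq7 hq13 a.ne_zero (u := u') (x := x') (y := y') hk hu' ?_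
    simpa only [eq_ratCast] using h'
  have h2 := key ((Rat.HeightOneSpectrum.primesEquiv (R := 𝓞 ℚ)).symm ⟨q, Fact.out⟩)
  rw [Equiv.apply_symm_apply] at h2
  exact h2 rfl

/-! ## §4 `#Sel^ψ(E'/ℚ) ≤ 125`: the Kummer invariant lands in the classes of `2^a 7^b 13^c` -/

/-- **Every representative `a` of the Kummer invariant of a `ψ`-Selmer class has `5 ∣ v_q(a)` for all primes
`q ∉ {2, 7, 13}`.** [cite: SilvermanAEC2009, Thm. X.4.2 and Prop. X.4.9] [cite: Fisher2001FiveSevenDescent, §2] -/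
theorem five_dvd_padicValRat_of_mem_selmerGroup {ξ : ψ.galH1Ker} (hξ : ξ ∈ ψ.selmerGroup) {a : ℚˣ}
    (ha : kummerInvariant (fiveIsogeny (13 : ℚ) 14) ψ hψ (Tbar (13 : ℚ) 14) (five_zsmul_Tbar (13 : ℚ) 14)
      (smul_Tbar (13 : ℚ) 14) (ker_fiveIsogeny_eq_zmultiples (13 : ℚ) 14) ξ = Additive.ofMul (QuotientGroup.mk a))
    (q : ℕ) [Fact q.Prime] (hq2 : q ≠ 2) (hq7 : q ≠ 7) (hq13 : q ≠ 13) :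
    (5 : ℤ) ∣ padicValRat q (a : ℚ) := by
  letI := ψ.kerAction
  obtain ⟨c, rfl⟩ := oneCocycleClass_surjective _ ξ
  obtain ⟨α, a₀, hαp, hcα⟩ := exists_root_of_cocycle (fiveIsogeny (13 : ℚ) 14) ψ hψ (Tbar (13 : ℚ) 14)
    (five_zsmul_Tbar (13 : ℚ) 14) (smul_Tbar (13 : ℚ) 14) (ker_fiveIsogeny_eq_zmultiples (13 : ℚ) 14) c
  have h0 := five_dvd_padicValRat_of_generator ψ hψ c hξ hαp hcα q hq2 hq7 hq13
  -- `a ≡ a₀ (mod ℚˣ⁵)`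
  have hinv := kummerInvariant_oneCocycleClass_eq_of_root (fiveIsogeny (13 : ℚ) 14) ψ hψ (Tbar (13 : ℚ) 14)
    (five_zsmul_Tbar (13 : ℚ) 14) (smul_Tbar (13 : ℚ) 14) (ker_fiveIsogeny_eq_zmultiples (13 : ℚ) 14) c hαp hcα
  rw [ha] at hinv
  have hq' : (QuotientGroup.mk a : ℚˣ ⧸ (powMonoidHom 5 : ℚˣ →* ℚˣ).range) = QuotientGroup.mk a₀ :=
    Additive.ofMul.injective hinv
  rw [QuotientGroup.eq] at hq'
  obtain ⟨w, hw⟩ := hq'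
  have haw : (a₀ : ℚ) = a * (w : ℚ) ^ 5 := by
    have := congrArg (fun z : ℚˣ ↦ (z : ℚ)) hw
    simp only [powMonoidHom_apply, Units.val_mul, Units.val_pow_eq_pow_val, Units.val_inv_eq_inv_val] at this
    field_simp at this
    linear_combination -this
  have hv : padicValRat q (a₀ : ℚ) = padicValRat q (a : ℚ) + 5 * padicValRat q (w : ℚ) := by
    rw [haw, padicValRat.mul a.ne_zero (pow_ne_zero _ w.ne_zero), padicValRat.pow]
    push_cast; ring
  obtain ⟨m, hm⟩ := h0
  exact ⟨m - padicValRat q (w : ℚ), by linarith⟩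

include hψ in
/-- **`#Sel^ψ(E'/ℚ) ≤ 125`.** The injective Kummer invariant (`kummerInvariant_injective`) followed by
`a ↦ (v₂(a), v₇(a), v₁₃(a)) mod 5` is injective on the Selmer group: two Selmer classes with the same exponents
at `2, 7, 13` differ by a class all of whose valuations are divisible by `5`, i.e. a fifth power (tree
`X1Eleven.exists_eq_pow_of_forall_dvd_padicValRat`). [cite: SilvermanAEC2009, Prop. X.4.9 and Exercise 10.1(c)]
[cite: Fisher2001FiveSevenDescent, §2] -/
theorem natCard_selmerGroup_dual_le : Nat.card ψ.selmerGroup ≤ 125 := by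
  letI := ψ.kerAction
  set Κ := kummerInvariant (fiveIsogeny (13 : ℚ) 14) ψ hψ (Tbar (13 : ℚ) 14) (five_zsmul_Tbar (13 : ℚ) 14)
    (smul_Tbar (13 : ℚ) 14) (ker_fiveIsogeny_eq_zmultiples (13 : ℚ) 14) with hΚ
  have hΚinj : Function.Injective Κ := kummerInvariant_injective _ _ _ _ _ (Tbar_ne_zero (13 : ℚ) 14) _ _
  -- a representative in `ℚˣ` of the invariant of each class
  have hrep : ∀ ξ : ψ.galH1Ker, ∃ a : ℚˣ, Κ ξ = Additive.ofMul (QuotientGroup.mk a) := fun ξ ↦ by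
    obtain ⟨a, ha⟩ := QuotientGroup.mk_surjective (Additive.toMul (Κ ξ))
    exact ⟨a, by rw [ha]; rfl⟩
  choose rep hrep using hrep
  let g : ψ.selmerGroup → ZMod 5 × ZMod 5 × ZMod 5 := fun ξ ↦
    ((padicValRat 2 (rep ξ : ℚ) : ZMod 5), (padicValRat 7 (rep ξ : ℚ) : ZMod 5), (padicValRat 13 (rep ξ : ℚ) : ZMod 5))
  have hg : Function.Injective g := by
    intro ξ ξ' hgg
    simp only [g, Prod.mk.injEq] at hgg
    obtain ⟨h2, h7, h13⟩ := hgg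
    -- the quotient `a/a'` represents `Κ (ξ - ξ')`
    have hdiff : Κ ((ξ : ψ.galH1Ker) - ξ') = Additive.ofMul (QuotientGroup.mk (rep ξ / rep ξ')) := by
      rw [map_sub, hrep, hrep, QuotientGroup.mk_div, ofMul_div]
    have hmem : ((ξ : ψ.galH1Ker) - ξ') ∈ ψ.selmerGroup := ψ.selmerGroup.sub_mem ξ.2 ξ'.2
    have hall : ∀ q : ℕ, q.Prime → (5 : ℤ) ∣ padicValRat q ((rep ξ / rep ξ' : ℚˣ) : ℚ) := by
      intro q hq
      haveI : Fact q.Prime := ⟨hq⟩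
      have hdiv : ((rep ξ / rep ξ' : ℚˣ) : ℚ) = (rep ξ : ℚ) / (rep ξ' : ℚ) := Units.val_div_eq_div_val _ _
      by_cases hq2 : q = 2
      · subst hq2; rw [hdiv, padicValRat.div (rep ξ).ne_zero (rep ξ').ne_zero]
        exact (ZMod.intCast_eq_intCast_iff_dvd_sub _ _ 5).mp h2.symm
      by_cases hq7 : q = 7
      · subst hq7; rw [hdiv, padicValRat.div (rep ξ).ne_zero (rep ξ').ne_zero]
        exact (ZMod.intCast_eq_intCast_iff_dvd_sub _ _ 5).mp h7.symm
      by_cases hq13 : q = 13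
      · subst hq13; rw [hdiv, padicValRat.div (rep ξ).ne_zero (rep ξ').ne_zero]
        exact (ZMod.intCast_eq_intCast_iff_dvd_sub _ _ 5).mp h13.symm
      exact five_dvd_padicValRat_of_mem_selmerGroup ψ hψ hmem hdiff q hq2 hq7 hq13
    obtain ⟨w, hw0, hw⟩ := X1Eleven.exists_eq_pow_of_forall_dvd_padicValRat (rep ξ / rep ξ').ne_zero
      (by decide : Odd 5) hall
    have h1 : (QuotientGroup.mk (rep ξ / rep ξ') : ℚˣ ⧸ (powMonoidHom 5 : ℚˣ →* ℚˣ).range) = 1 := by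
      rw [QuotientGroup.eq_one_iff]
      exact ⟨Units.mk0 w hw0, Units.ext (by rw [powMonoidHom_apply, Units.val_pow_eq_pow_val, Units.val_mk0, ← hw])⟩
    rw [h1, ofMul_one] at hdiff
    have h0 : (ξ : ψ.galH1Ker) - ξ' = 0 := hΚinj (by rw [hdiff, map_zero])
    exact Subtype.ext (sub_eq_zero.mp h0)
  have hcard := Nat.card_le_card_of_injective g hg
  simpa [Nat.card_prod] using hcard

/-! ## §5 `Ш(E_{13/14}/ℚ)[5] = 0` and `t₅ = 0` -/

section PointCount

/- The generic isogeny library carries `E(ℚ)` with the classical `DecidableEq ℚ`; align and convert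
`KubertTate1314Descent.card_quotient_eq` along `Subsingleton.elim` (as in route ShaPrimaryTransfer's
`…DoorAtFiveDual`). -/
attribute [local instance 10000] Classical.propDecidable

include hψ in
/-- **`[E(ℚ) : ψ(E'(ℚ))] = 125`**: `E'(ℚ) = φ(E(ℚ))` (`Sel^φ = 0`, tree) and `ψ ∘ φ = [5]`, so `ψ(E'(ℚ)) = 5E(ℚ)`, of
index `#E(ℚ)/5E(ℚ) = 125` (tree `card_quotient_eq`). [cite: SilvermanAEC2009, Thm. X.4.2(a), Thm. X.1.1] -/
theorem index_range_pointHom_dual (g : (kubertTateFive' (13 : ℚ) 14).toAffine.Point →+ E.toAffine.Point)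
    (hg : ∀ P', E.toGeomPoints (g P') = ψ ((kubertTateFive' (13 : ℚ) 14).toGeomPoints P')) : g.range.index = 125 := by
  obtain ⟨f, hf⟩ := (fiveIsogeny (13 : ℚ) 14).exists_pointHom
  have hgf : ∀ P : E.toAffine.Point, g (f P) = (5 : ℕ) • P := fun P ↦ by
    apply toGeomPoints_injective E
    rw [hg, hf, hψ, map_nsmul, natCast_zsmul]
  have hrange : g.range = (nsmulAddMonoidHom (5 : ℕ) : E.toAffine.Point →+ E.toAffine.Point).range := by
    ext Q
    constructor
    · rintro ⟨P', rfl⟩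
      obtain ⟨P, hP⟩ := ConstantKernelDescent.exists_toGeomPoints_eq_of_selmerGroup_eq_bot
        (fiveIsogeny (13 : ℚ) 14) selmerGroup_fiveIsogeny_eq_bot P'
      have hP' : P' = f P := toGeomPoints_injective (kubertTateFive' (13 : ℚ) 14) (by rw [hP, hf])
      exact ⟨P, by rw [nsmulAddMonoidHom_apply, hP', hgf]⟩
    · rintro ⟨P, rfl⟩
      exact ⟨f P, by rw [nsmulAddMonoidHom_apply, hgf]⟩
  rw [hrange, AddSubgroup.index_eq_card]
  have h := card_quotient_eq
  have hinst : (instDecidableEqRat : DecidableEq ℚ) = fun a b ↦ Classical.propDecidable (a = b) :=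
    Subsingleton.elim _ _
  rw [hinst] at h
  exact h

include hψ in
/-- **`#Sel^ψ(E'/ℚ) = 125 · #ker Ш(ψ)`** (Silverman X.4.2(a) counted, tree `Isogeny.natCard_selmerGroup_eq`).
[cite: SilvermanAEC2009, Thm. X.4.2(a)] -/
theorem natCard_selmerGroup_dual :
    Nat.card ψ.selmerGroup =
      125 * Nat.card (shaMap ψ.toAddMonoidHom ψ.equivariant ψ.hasLocalPointsMaps_toAddMonoidHom).ker := by
  obtain ⟨g, hg⟩ := ψ.exists_pointHom
  rw [ψ.natCard_selmerGroup_eq g hg, index_range_pointHom_dual ψ hψ g hg]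

end PointCount

include hψ in
/-- **`Ш(E'/ℚ)[ψ] = 0`**: the kernel of `Ш(ψ)` is trivial (`125 · #ker = #Sel^ψ ≤ 125`).
[cite: SilvermanAEC2009, Thm. X.4.2(a) and Prop. X.4.9] -/
theorem ker_shaMap_dual_eq_bot :
    (shaMap ψ.toAddMonoidHom ψ.equivariant ψ.hasLocalPointsMaps_toAddMonoidHom).ker = ⊥ := by
  haveI : Finite (shaMap ψ.toAddMonoidHom ψ.equivariant ψ.hasLocalPointsMaps_toAddMonoidHom).ker :=
    (finite_ker_shaMap ψ.toAddMonoidHom ψ.equivariant ψ.hasLocalPointsMaps_toAddMonoidHom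
      (fiveIsogeny (13 : ℚ) 14).toAddMonoidHom (fiveIsogeny (13 : ℚ) 14).equivariant (n := 5) (by norm_num)
      (fun Q ↦ by
        obtain ⟨P, rfl⟩ := (fiveIsogeny (13 : ℚ) 14).surjective Q
        rw [Isogeny.coe_toAddMonoidHom, Isogeny.coe_toAddMonoidHom, hψ, map_zsmul])).to_subtype
  have h1 := natCard_selmerGroup_dual ψ hψ
  have h2 := natCard_selmerGroup_dual_le ψ hψ
  have hpos : 0 < Nat.card (shaMap ψ.toAddMonoidHom ψ.equivariant ψ.hasLocalPointsMaps_toAddMonoidHom).ker :=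
    Nat.card_pos
  have hone : Nat.card (shaMap ψ.toAddMonoidHom ψ.equivariant ψ.hasLocalPointsMaps_toAddMonoidHom).ker = 1 := by
    omega
  exact AddSubgroup.eq_bot_of_card_eq _ hone

/-- **`Ш(E_{13/14}/ℚ)[5] = 0`** — the complete `5`-descent: `Ш(E)[φ] = 0` (the `ℤ/5`-side, tree) and `Ш(E')[φ̂] = 0`
(the `μ₅`-side, this file) bracket `Ш(E)[5]` (tree `sha_torsionBy_eq_bot_of_ker_shaMap_eq_bot`).
[cite: SilvermanAEC2009, Thm. X.4.2(a)] [cite: Fisher2001FiveSevenDescent, §2] -/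
theorem sha_torsionBy_five_eq_bot : E.sha[((5 : ℕ) : ℤ)] = ⊥ := by
  obtain ⟨ψ, hψ⟩ := exists_dual
  exact sha_torsionBy_eq_bot_of_ker_shaMap_eq_bot (fiveIsogeny (13 : ℚ) 14) ψ (n := 5) (by norm_num) hψ
    (ConstantKernelDescent.ker_shaMap_eq_bot_of_selmerGroup_eq_bot (fiveIsogeny (13 : ℚ) 14)
      selmerGroup_fiveIsogeny_eq_bot)
    (ker_shaMap_dual_eq_bot ψ hψ)

/-- **`Ш(E_{13/14}/ℚ)` has no element of order `5`.** [cite: SilvermanAEC2009, Thm. X.4.2(a)] -/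
theorem forall_mem_sha_five_nsmul_eq_zero : ∀ c ∈ E.sha, (5 : ℕ) • c = 0 → c = 0 := by
  intro c hc h5
  have hmem : (⟨c, hc⟩ : E.sha) ∈ E.sha[((5 : ℕ) : ℤ)] := AddSubgroup.torsionBy.nsmul_iff.mpr (Subtype.ext h5)
  rw [sha_torsionBy_five_eq_bot, AddSubgroup.mem_bot] at hmem
  exact congrArg Subtype.val hmem

/-- **`t₅(E_{13/14}) = corank_{ℤ₅} Ш(E_{13/14}/ℚ)[5^∞] = 0`, UNCONDITIONALLY** — the `5`-primary part of the
Tate–Shafarevich group of the rank-`2` curve `y² + xy − 2548y = x³ − 182x²` is finite (indeed `Ш[5] = 0`), at the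
prime `5` of good ordinary (anomalous) reduction, by `5`-descent alone. [cite: SilvermanAEC2009, Thm. X.4.2(a)]
[cite: Fisher2001FiveSevenDescent, §2] -/
theorem shaCorank_five_eq_zero : E.shaCorank 5 = 0 :=
  E.shaCorank_eq_zero_of_forall 5 forall_mem_sha_five_nsmul_eq_zero

/-- **`Ш(E_{13/14}/ℚ)[5^∞] = 0`** (the whole `5`-primary component is trivial). [cite: SilvermanAEC2009, Thm. X.4.2(a)] -/
theorem primaryComponent_sha_five_eq_bot : AddCommGroup.primaryComponent E.sha 5 = ⊥ :=
  E.primaryComponent_sha_eq_bot_of_forall forall_mem_sha_five_nsmul_eq_zero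

/-- **`s₅(E_{13/14}) = corank_{ℤ₅} Sel_{5^∞}(E_{13/14}/ℚ) = 2 = rank E_{13/14}(ℚ)`** (`s_p = r + t_p`, tree
`selmerCorank_eq_mordellWeilRank_add_holds`; `r = 2`, tree `mordellWeilRank_eq_two`; `t₅ = 0` above).
[cite: SilvermanAEC2009, Thm. X.4.2(b)] -/
theorem selmerCorank_five_eq_two : E.selmerCorank 5 = 2 := by
  rw [E.selmerCorank_eq_mordellWeilRank_add_holds 5, shaCorank_five_eq_zero, mordellWeilRank_eq_two]

include hψ in
/-- `φ ∘ ψ = [5]` on `E'(ℚ̄)` (`φ` is onto `E'(ℚ̄)`). [cite: SilvermanAEC2009, Thm. III.6.2(a)] -/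
theorem comp_dual_eq (Q : geomPoints (kubertTateFive' (13 : ℚ) 14)) : fiveIsogeny (13 : ℚ) 14 (ψ Q) = ((5 : ℕ) : ℤ) • Q := by
  obtain ⟨P, rfl⟩ := (fiveIsogeny (13 : ℚ) 14).surjective Q
  rw [hψ, map_zsmul]

/-- **`Ш(E'/ℚ)[5] = 0` on the isogenous curve `E' = E/⟨T⟩ = [1, -182, -2548, -306670, -121427670]`**:
`#Ш(E'/ℚ)[5] = #ker Ш(ψ)` because `ker Ш(φ) = ⊥` and `φ ∘ ψ = [5]` (tree
`natCard_sha_torsionBy_eq_of_ker_shaMap_eq_bot`), and `ker Ш(ψ) = ⊥` (`ker_shaMap_dual_eq_bot`).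
[cite: SilvermanAEC2009, Thm. X.4.2(a)] [cite: Fisher2001FiveSevenDescent, §2] -/
theorem sha_torsionBy_five_E'_eq_bot : (kubertTateFive' (13 : ℚ) 14).sha[((5 : ℕ) : ℤ)] = ⊥ := by
  obtain ⟨ψ, hψ⟩ := exists_dual
  have hker := ker_shaMap_dual_eq_bot ψ hψ
  haveI : Finite (shaMap ψ.toAddMonoidHom ψ.equivariant ψ.hasLocalPointsMaps_toAddMonoidHom).ker := by
    rw [hker]; infer_instance
  have h := natCard_sha_torsionBy_eq_of_ker_shaMap_eq_bot ψ (fiveIsogeny (13 : ℚ) 14) (n := 5) (by norm_num)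
    (comp_dual_eq ψ hψ)
    (ConstantKernelDescent.ker_shaMap_eq_bot_of_selmerGroup_eq_bot (fiveIsogeny (13 : ℚ) 14)
      selmerGroup_fiveIsogeny_eq_bot)
  rw [hker, AddSubgroup.card_bot] at h
  exact AddSubgroup.eq_bot_of_card_eq _ h

/-- `Ш(E'/ℚ)` has no element of order `5`. [cite: SilvermanAEC2009, Thm. X.4.2(a)] -/
theorem forall_mem_sha_E'_five_nsmul_eq_zero : ∀ c ∈ (kubertTateFive' (13 : ℚ) 14).sha, (5 : ℕ) • c = 0 → c = 0 := by
  intro c hc h5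
  have hmem : (⟨c, hc⟩ : (kubertTateFive' (13 : ℚ) 14).sha) ∈ (kubertTateFive' (13 : ℚ) 14).sha[((5 : ℕ) : ℤ)] := AddSubgroup.torsionBy.nsmul_iff.mpr (Subtype.ext h5)
  rw [sha_torsionBy_five_E'_eq_bot, AddSubgroup.mem_bot] at hmem
  exact congrArg Subtype.val hmem

/-- **`t₅(E') = 0`** for the isogenous curve `E' = [1, -182, -2548, -306670, -121427670]` (rank `2`).
[cite: SilvermanAEC2009, Thm. X.4.2(a)] -/
theorem shaCorank_five_E'_eq_zero : (kubertTateFive' (13 : ℚ) 14).shaCorank 5 = 0 :=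
  (kubertTateFive' (13 : ℚ) 14).shaCorank_eq_zero_of_forall 5 forall_mem_sha_E'_five_nsmul_eq_zero

/-- **`Ш(E'/ℚ)[5^∞] = 0`.** [cite: SilvermanAEC2009, Thm. X.4.2(a)] -/
theorem primaryComponent_sha_five_E'_eq_bot : AddCommGroup.primaryComponent (kubertTateFive' (13 : ℚ) 14).sha 5 = ⊥ :=
  (kubertTateFive' (13 : ℚ) 14).primaryComponent_sha_eq_bot_of_forall forall_mem_sha_E'_five_nsmul_eq_zero

end KubertTate1314Descent

end Literature.NumberTheory.EllipticCurves

end
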